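import Literature.NumberTheory.EllipticCurves.Kim2026.ShaLengthRankZeroLowerBoundMultiplicative
import Literature.NumberTheory.EllipticCurves.LocalTorsionGoodReductionProofs
import HarnessLib

/-!
# Kim 2026, Thm. 1.8 (6), DEEP certificate, the `t = 0` twin: bridges and the reading on the
# multiplicative locus (theorems only; 0 definitions, 0 named facts)

Sibling of `Kim2026/ShaLengthRankZeroLowerBoundMultiplicative` (the named fact
`rankZero_le_padicValNat_sha_of_kuriharaNumber_ne_zero_of_splitMultiplicative_or_localTorsionTrivial`
and the page-level reading of C.-H. Kim, Amer. J. Math. 148 (2026), §3.2.1 / Lemma 3.9 / Thm. 3.13 /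
§5.4 that justifies it; cell `bsd-print-x11a`, seat ty1, TURNKEY T38). Proved here:

* `…_of_splitMultiplicative_or_localTorsionTrivial_of` — literal fact ⇒ twin (the extra binder is
  dropped): the twin is WEAKER than the literal fact `rankZero_le_padicValNat_sha_of_kuriharaNumber_ne_zero`.
* `rankZero_le_padicValNat_sha_of_kuriharaNumber_ne_zero_of_localTorsionTrivial_of_splitMultiplicative_or`
  — twin ⇒ `(t0)` twin of `Kim2026/ShaLengthRankZeroLowerBound` (`Or.inr`): the twin sits between the
  two landed `Prop`s.
* `rankZero_le_padicValNat_sha_of_kuriharaNumber_ne_zero_of_multiplicative` — the twin READ ON THE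
  MULTIPLICATIVE LOCUS: its binder "split multiplicative at `p` ∨ `#E(ℚ_p)[p] = 1`" (Kim's `t = 0`)
  DISCHARGED by `W.HasMultiplicativeReductionAtPrime p` — split ⇒ left disjunct; non-split ⇒ right
  disjunct by `natCard_localPTorsion_eq_one_of_mult` (Silverman AEC VII.6.1 / Ex. 3.5; Kim §3.1.2).
  This is the shape a `ClassX11a` door consumes (no local-torsion datum, no `v_p(Δ_min)` condition,
  no Tate certificate, any depth `k ≥ 1`).

## References
* C.-H. Kim, Amer. J. Math. 148 (2026) 79–129 = arXiv:2203.12159: Thm. 1.9 (6), §3.1.2, §3.2.1,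
  Thm. 3.13. [Kim2022StructureSelmer]
* J. H. Silverman, *The Arithmetic of Elliptic Curves*, GTM 106 (2009): VII.3 Prop. 3.1, Thm. VII.6.1,
  Exercise 3.5. [SilvermanAEC2009]
-/

noncomputable section

open scoped MatrixGroups ModularForm Classical

open WeierstrassCurve CongruenceSubgroup Literature.NumberTheory.EllipticCurves.ModularForms

namespace Literature.NumberTheory.EllipticCurves.Kim2026

/-- Bridge: the literal fact implies the `t = 0` twin (one more hypothesis, dropped). Proved.
[cite: Kim2022StructureSelmer, Thm. 1.9 (6) (PDF p. 8)] -/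
theorem rankZero_le_padicValNat_sha_of_kuriharaNumber_ne_zero_of_splitMultiplicative_or_localTorsionTrivial_of
    (h : rankZero_le_padicValNat_sha_of_kuriharaNumber_ne_zero) :
    rankZero_le_padicValNat_sha_of_kuriharaNumber_ne_zero_of_splitMultiplicative_or_localTorsionTrivial :=
  fun W _ _ p _ hp hsurj _ hL hfin _ _ D hc hu k n _ hk hn hcyc ψ hψ hδ ↦
    h W p hp hsurj hL hfin D hc hu k n hk hn hcyc ψ hψ hδ

/-- Bridge: the `t = 0` twin implies the `(t0)` twin of the sibling file (its binder is the right
disjunct). Proved. [cite: Kim2022StructureSelmer, Thm. 1.9 (6) (PDF p. 8), §3.2.1 (PDF p. 15)] -/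
theorem rankZero_le_padicValNat_sha_of_kuriharaNumber_ne_zero_of_localTorsionTrivial_of_splitMultiplicative_or
    (h : rankZero_le_padicValNat_sha_of_kuriharaNumber_ne_zero_of_splitMultiplicative_or_localTorsionTrivial) :
    rankZero_le_padicValNat_sha_of_kuriharaNumber_ne_zero_of_localTorsionTrivial :=
  fun W _ _ p _ hp hsurj ht0 hL hfin _ _ D hc hu k n _ hk hn hcyc ψ hψ hδ ↦
    h W p hp hsurj (Or.inr ht0) hL hfin D hc hu k n hk hn hcyc ψ hψ hδ

/-- **The twin READ ON THE MULTIPLICATIVE LOCUS** — Kim 2026, Thm. 1.8 (6), analytic rank `0`, a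
certificate `δ̃_n^{(k)} ≠ 0` at depth `k`, LOWER bound `ord_p(L(E,1)/Ω) ≤ ord_p #Ш(p) + (k − 1)`, with
the `t = 0` binder DISCHARGED by `W.HasMultiplicativeReductionAtPrime p`: split ⇒ the left disjunct;
non-split ⇒ `#E(ℚ_p)[p] = 1` by `natCard_localPTorsion_eq_one_of_mult` (Tate curve twisted by the
unramified quadratic character; Silverman AEC VII.6.1 / Ex. 3.5; Kim §3.1.2 "Thus `E(ℚ_p)[p]` is
trivial", p0015:L50). No local-torsion datum, no `v_p(Δ_min)` condition, any depth `k ≥ 1`. Proved (a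
reading of the twin; nothing asserted). This is the shape a `ClassX11a` door consumes.
[cite: Kim2022StructureSelmer, Thm. 1.9 (6) (PDF p. 8), §3.1.2 and §3.2.1 (PDF p. 15), Thm. 3.13 (PDF p. 17)]
[cite: SilvermanAEC2009, VII.3 Prop. 3.1, Thm. VII.6.1 and Exercise 3.5] -/
theorem rankZero_le_padicValNat_sha_of_kuriharaNumber_ne_zero_of_multiplicative
    (h : rankZero_le_padicValNat_sha_of_kuriharaNumber_ne_zero_of_splitMultiplicative_or_localTorsionTrivial) :
    ∀ (W : WeierstrassCurve ℚ) [W.IsElliptic] [W.IsGloballyMinimal] (p : ℕ) [Fact p.Prime],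
    5 ≤ p → W.HasMultiplicativeReductionAtPrime p → W.HasSurjectiveModNGaloisRep p →
    W.entireLFunction 1 ≠ 0 → Finite W.sha →
    ∀ {N : ℕ} [NeZero N] (D : ModularParametrizationData W N),
    ¬ (p : ℤ) ∣ D.maninConstant →
    (∃ u : ℚ, ‖(u : ℚ_[p])‖ = 1 ∧ W.realPeriodRat = u * plusPeriod D.f) →
    ∀ (k n : ℕ) [NeZero n], 1 ≤ k → Kato.IsKolyvaginProduct W p k n →
    (∀ (ℓ : ℕ) [Fact ℓ.Prime], ℓ ∣ n →
      Nat.card {P : ((WeierstrassCurve.integralModelInt W).map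
          (Int.castRingHom (ZMod ℓ))).toAffine.Point // p • P = 0} ≤ p) →
    ∀ ψ : (ℓ : ℕ) → (ZMod ℓ)ˣ →* Multiplicative (ZMod (p ^ k)),
      (∀ ℓ ∈ n.primeFactors, Function.Surjective (ψ ℓ)) →
      kuriharaNumber D.f (p ^ k) n ψ ≠ 0 →
    ∃ q : ℚ, W.entireLFunction 1 / (W.realPeriodRat : ℂ) = (q : ℂ) ∧
      padicValRat p q ≤
        (padicValNat p (Nat.card (AddCommGroup.primaryComponent W.sha p)) : ℤ) + ((k - 1 : ℕ) : ℤ) := by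
  intro W _ _ p _ hp hmult hsurj hL hfin N _ D hc hu k n _ hk hn hcyc ψ hψ hδ
  have ht : W.HasSplitMultiplicativeReductionAtPrime p ∨
      Nat.card {Q : (W.baseChange ℚ_[p]).toAffine.Point // (p : ℕ) • Q = 0} = 1 := by
    by_cases hs : W.HasSplitMultiplicativeReductionAtPrime p
    · exact Or.inl hs
    · exact Or.inr (natCard_localPTorsion_eq_one_of_mult W p (by omega) hmult (Or.inl hs))
  exact h W p hp hsurj ht hL hfin D hc hu k n hk hn hcyc ψ hψ hδ

end Literature.NumberTheory.EllipticCurves.Kim2026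

end
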